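/-
Copyright: statement-level skeleton of a published paper (lit-balaban cell, Phase-2 proof seat p25, gen 16). No proof
claims beyond what the kernel checks below.
-/
import Literature.MathematicalPhysics.QuantumFieldTheory.BalabanImbrieJaffe1984to88.BIJ88LabelledExpansion311
import Mathlib.Algebra.BigOperators.Group.Finset.Powerset

/-!
# `BalabanImbrieJaffe1984to88.BIJ88Resummation312` — T. Bałaban, J. Imbrie, A. Jaffe, *Effective action and cluster
properties of the abelian Higgs model*, Commun. Math. Phys. **114** (1988) 257–315 [BalabanImbrieJaffe1988], §5.14
p. 312 [PDF 56] *"We can arrange the construction so that the {X_c} are determined once the remainder components are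
specified. Summing all possible diagrams in X_c gives the observable for the next step there, F^L_{k+1,loc}(X_c).
Summing all terms in X_r gives an observable F_{k,rem}(X_r). Then the result of the integration by parts is
⟨Π_{σ_i} F^{m̄}_{k,loc}(X_{σ_i})⟩ = Σ_{{X_r}} Π_{c: X_c ⊄ ∪_r X_r} F^L_{k+1,loc}(X_c) ⟨Π_r F_{k,rem}(X_r)⟩"* — **THE
RESUMMATION OVER THE CONSTANT COMPONENTS, DERIVED AT EVERY ORDER IN THE INTERACTION** (contraction-graph components):
for the labelled component expansion `expand` of `BIJ88LabelledExpansion311` — print's integration by parts with its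
stopping rule, components labelled by the observables `K` they contain — the value splits as
`Σ_t coef_t ∫(t) = Σ_{O ⊆ K} CST(K ∖ O) · REM(O)`: `O` = the observables lying in remainder components, `REM(O)` = the
terms of the expansion OF `O` ALONE with no constant component (*"Summing all terms in X_r gives … F_{k,rem}(X_r)"*),
`CST(C)` = the sum of the coefficients of the all-constant terms of the expansion OF `C` ALONE — a sum over the ways
`C` organises into constant components, each carrying its own sum of connected constant diagrams `F^L`
(`cst_step`: the component of the least observable of `C` absorbs `B`, contributes `FL(min C, B)`, and the rest
organises independently).  The two ENVIRONMENT LEMMAS of `BIJ88LabelledRunEnv311` are the mechanism: a run sees only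
the observables it absorbs; a constant component sees nothing else at all.

statement-level skeleton of published theorems with citation tags; proofs where landed; nothing here is a claim
about the Yang–Mills mass gap

PDF held: `paper:balaban1988-cmp114-bij-abelian-higgs-effective-action` (journal page = PDF page + 256); p. 311–312 =
PDF 55–56 (`p0055.txt` L23–38, `p0056.txt` L1–9 re-read this session).

CITATION HEADER (lean-in-tree rule).  lit-balaban cell (HOME `run/shared/lean/pub/lit-balaban/`), Phase 2, seat p25
gen 16; row **C2.Claim@312** of `HOME/lit-balaban-r16/ROWS-C2-part2.md` (owner r16, referee ref-5; head untouched —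
this is honest-scope item (c) "resummation" of p25 gen 15's `BIJ88VertexComponents311`, for contraction-graph
components; the analytic estimate of the remainder components stays the row's open head question).  USED BY NAME,
nothing restated: `BIJ88LabelledRun311` / `BIJ88LabelledRunEnv311` / `BIJ88LabelledExpansion311` (this seat and
generation; `run_filter_env`, `run_filter_const`, `run_const`, `expand`, `expand_sound`, `expand_val_init`, `tval`).

## What is proved (0 `sorry`, standard axioms, no new `Prop` facts; definitions with bodies: `cst`, `fl`, `remv`)

* §0 bookkeeping of sums (`sum_map_ite`, `sum_map_finset_sum_comm`, `sum_map_fiber`, `powerset_filter_subset`,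
  `sum_powerset_sdiff_reindex`, `min'_eq_of_subset`, `sum_mbind`; §3 `sdiff_insert_eq_erase_sdiff`,
  `sdiff_erase_eq_erase_sdiff`).
* §1 `cst` (*"Summing all possible diagrams in X_c"*, all constant components of `C` together), `fl` (ONE constant
  component: the run of the least observable absorbing exactly `B`), `remv` (*"Summing all terms in X_r"*);
  **`cst_step`**, **`remv_step`** (one observable taken up); `expand_lab` (the blocks and set-aside components of a
  term carry all the observables: `⋃ lab (consts + groups) = ⋃ lab done ∪ rest`).
* §2 the environment lemmas in sum form: `sum_filter_env`, `cst_env`, `remv_env`.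
* §3 **`expand_resum`** — THE RESUMMATION: for complete `done`, untouched `rest`, directions `D`:
  `Σ_{t ∈ expand done rest} tval D t = Σ_{O ⊆ rest} cst (rest ∖ O) · remv D done O`.
  The display itself (from nothing set aside; the constant part organised into components `Π_c F^L(X_c)` over set
  partitions; normalized) is the sibling `BIJ88Resummation312Display`.
HONEST SCOPE.  (a) Components are CONTRACTION-GRAPH components with one covariance (no `C_loc` split, no random-walk
trigger), the order of events inside a component is fixed (head leg first) and observables are taken up in the order
of `κ` — print's components are geometric; (b) `REM(O)` is one block (the remainder components of `O` are not
factorised further — print does not either: `⟨Π_r F_{k,rem}(X_r)⟩` is one expectation); (c) no estimates: the sizes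
of `cst`, `fl`, `remv` (p. 312 *"appropriate bounds"*) are the row's open head question.  CURRENCY (asked by the row
owner r16): this file feeds NONE of `BIJ88Sect5StatementsPart4.Ineq312`, `hobs`, `RemainderComponent` by name — it
does not import `BIJ88Sect5StatementsPart4` and concludes in the currency of `BIJ88LabelledExpansion311` (`expand`,
`tval`, `gintM`); the head `Ineq312` (typed at print's ceiling) is untouched.  NOT summit progress; NOT
continuum; NOT Clay.  Imports `BIJ88LabelledExpansion311`, `Mathlib.Algebra.BigOperators.Group.Finset.Powerset`;
modifies nothing.
-/

noncomputable section

namespace Literature.MathematicalPhysics.QuantumFieldTheory.BalabanImbrieJaffe1984to88.BIJ88Resummation312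

open Classical MeasureTheory Matrix Finset
open scoped BigOperators
open Literature.MathematicalPhysics.QuantumFieldTheory.Balaban1983to89
open B2Eq228Conditioning (weight source)
open BIJ88VertexIbp311 (lmono vexp)
open BIJ88WickDerivatives305 (dlist)
open BIJ88VertexComponents311 (Grp maxArity)
open BIJ88LabelledRun311 BIJ88LabelledRunEnv311 BIJ88LabelledExpansion311

variable {S : Type} [Fintype S] [DecidableEq S] {ι : Type} [Fintype ι] {κ : Type} [LinearOrder κ]

/-! ## §0  Bookkeeping of sums -/

omit [Fintype S] [DecidableEq S] [LinearOrder κ] in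
/-- A sum with an indicator is the sum over the filtered multiset (bookkeeping). [cite: BalabanImbrieJaffe1988, §5.14 p.312] -/
theorem sum_map_ite {X : Type} (p : X → Prop) [DecidablePred p] (ψ : X → ℝ) (m : Multiset X) :
    (m.map fun x => if p x then ψ x else 0).sum = ((m.filter p).map ψ).sum := by
  induction m using Multiset.induction_on with
  | empty => simp
  | cons a m ih =>
    rw [Multiset.map_cons, Multiset.sum_cons, ih, Multiset.filter_cons]
    split_ifs with h
    · rw [Multiset.singleton_add, Multiset.map_cons, Multiset.sum_cons]
    · rw [zero_add, zero_add]

omit [Fintype S] [DecidableEq S] [LinearOrder κ] in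
/-- Exchanging a multiset sum with a finite sum (bookkeeping). [cite: BalabanImbrieJaffe1988, §5.14 p.312] -/
theorem sum_map_finset_sum_comm {X Y : Type} (m : Multiset X) (s : Finset Y) (g : X → Y → ℝ) :
    (m.map fun x => ∑ y ∈ s, g x y).sum = ∑ y ∈ s, (m.map fun x => g x y).sum := by
  induction s using Finset.induction_on with
  | empty => simp
  | insert a s ha ih => simp only [Finset.sum_insert ha, Multiset.sum_map_add, ih]

omit [Fintype S] [DecidableEq S] [LinearOrder κ] in
/-- Splitting a multiset sum along the fibres of a key with finitely many values (bookkeeping).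
[cite: BalabanImbrieJaffe1988, §5.14 p.312] -/
theorem sum_map_fiber {X Y : Type} [DecidableEq Y] (key : X → Y) (ψ : X → ℝ) (s : Finset Y) :
    ∀ m : Multiset X, (∀ x ∈ m, key x ∈ s) →
      (m.map ψ).sum = ∑ y ∈ s, ((m.filter fun x => key x = y).map ψ).sum := by
  intro m
  induction m using Multiset.induction_on with
  | empty => intro; simp
  | cons a m ih =>
    intro hm
    rw [Multiset.map_cons, Multiset.sum_cons, ih (fun x hx => hm x (Multiset.mem_cons_of_mem hx))]
    have e : ∀ y ∈ s, (((a ::ₘ m).filter fun x => key x = y).map ψ).sum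
        = (if key a = y then ψ a else 0) + ((m.filter fun x => key x = y).map ψ).sum := fun y _ => by
      rw [Multiset.filter_cons]
      split_ifs with h
      · rw [Multiset.singleton_add, Multiset.map_cons, Multiset.sum_cons]
      · rw [zero_add, zero_add]
    rw [Finset.sum_congr rfl e, Finset.sum_add_distrib, Finset.sum_ite_eq, if_pos (hm a (Multiset.mem_cons_self a m))]

omit [Fintype S] [DecidableEq S] [LinearOrder κ] in
/-- The subsets of `R` inside `T ⊆ R` are the subsets of `T` (bookkeeping). [cite: BalabanImbrieJaffe1988, §5.14 p.312] -/
theorem powerset_filter_subset [DecidableEq κ] {R T : Finset κ} (hT : T ⊆ R) :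
    (R.powerset.filter fun O => O ⊆ T) = T.powerset := by
  ext O
  simp only [Finset.mem_filter, Finset.mem_powerset]
  exact ⟨fun h => h.2, fun h => ⟨h.trans hT, h⟩⟩

omit [Fintype S] [DecidableEq S] [LinearOrder κ] in
/-- Re-indexing the subsets `O'` of `R` with `R ∖ O' ⊆ T` by `O'' = T ∖ (R ∖ O') ⊆ T` (bookkeeping: which observables of
the environment the later components leave in remainder components). [cite: BalabanImbrieJaffe1988, §5.14 p.312] -/
theorem sum_powerset_sdiff_reindex [DecidableEq κ] {R T : Finset κ} (hT : T ⊆ R) (g : Finset κ → Finset κ → ℝ) :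
    ∑ O' ∈ R.powerset, (if R \ O' ⊆ T then g (R \ O') (T \ (R \ O')) else 0)
      = ∑ O'' ∈ T.powerset, g (T \ O'') O'' := by
  rw [← Finset.sum_filter]
  refine Finset.sum_nbij' (fun O' => T \ (R \ O')) (fun O'' => R \ (T \ O'')) ?_ ?_ ?_ ?_ ?_
  · intro O' _
    exact Finset.mem_powerset.2 Finset.sdiff_subset
  · intro O'' hO''
    rw [Finset.mem_powerset] at hO''
    refine Finset.mem_filter.2 ⟨Finset.mem_powerset.2 Finset.sdiff_subset, ?_⟩
    rw [Finset.sdiff_sdiff_eq_self ((Finset.sdiff_subset).trans hT)]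
    exact Finset.sdiff_subset
  · intro O' hO'
    obtain ⟨hO'R, hsub⟩ := Finset.mem_filter.1 hO'
    rw [Finset.mem_powerset] at hO'R
    rw [Finset.sdiff_sdiff_eq_self hsub, Finset.sdiff_sdiff_eq_self hO'R]
  · intro O'' hO''
    rw [Finset.mem_powerset] at hO''
    rw [Finset.sdiff_sdiff_eq_self ((Finset.sdiff_subset).trans hT), Finset.sdiff_sdiff_eq_self hO'']
  · intro O' hO'
    obtain ⟨-, hsub⟩ := Finset.mem_filter.1 hO'
    rw [Finset.sdiff_sdiff_eq_self hsub]

omit [Fintype S] [DecidableEq S] in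
/-- The least element of a subset containing the least element (bookkeeping: the least untouched observable).
[cite: BalabanImbrieJaffe1988, §5.14 p.312] -/
theorem min'_eq_of_subset {rest C : Finset κ} (h : rest.Nonempty) (hC : C ⊆ rest) (hi : rest.min' h ∈ C) :
    C.min' ⟨_, hi⟩ = rest.min' h :=
  le_antisymm (Finset.min'_le _ _ hi) (Finset.le_min' _ _ _ fun y hy => Finset.min'_le _ y (hC hy))

omit [Fintype S] [DecidableEq S] [LinearOrder κ] in
/-- A sum over `mbind` is an iterated sum (bookkeeping). [cite: BalabanImbrieJaffe1988, §5.14 p.312] -/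
theorem sum_mbind {X : Type} (m : Multiset X) (F : (a : X) → a ∈ m → Multiset ℝ) :
    (mbind m F).sum = (m.attach.map fun a => (F a.1 a.2).sum).sum := by
  rw [mbind, Multiset.sum_bind]

/-! ## §1  The constant part, one constant component, the remainder part; one observable taken up -/

variable (A : Matrix S S ℝ) (f : S → ℝ) (c : ι → ℝ) (legs : ι → List (S → ℝ)) (obs : κ → List (S → ℝ)) (M : ℕ)
  (χ : (S → ℝ) → ℝ)

/-- **The constant part of the observables `C`** (*"Summing all possible diagrams in X_c gives … F^L_{k+1,loc}(X_c)"*,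
over all the constant components together): the sum of the coefficients of the terms of the expansion of `C` alone
in which every component is constant — field-independent numbers. [cite: BalabanImbrieJaffe1988, §5.14 p.312] -/
def cst (C : Finset κ) : ℝ :=
  (((expand A f c legs obs M 0 C).filter fun t => t.groups = 0).map RTerm.coef).sum

/-- **One constant component `F^L`**: the sum of the weights of the runs of the pristine observable `i` in the
environment `B` that end CONSTANT having absorbed all of `B` — all connected constant diagrams on `{i} ∪ B`.
[cite: BalabanImbrieJaffe1988, §5.14 p.312] -/
def fl (i : κ) (B : Finset κ) : ℝ :=
  (((run A f c legs obs M (pristine obs i) B 0).filter fun o => o.g.IsConst M ∧ o.rest = ∅).map Outcome.a).sum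

/-- **The remainder part of the observables `O`** (*"Summing all terms in X_r gives an observable F_{k,rem}(X_r)"*,
all remainder components together, under the integral): the value of the terms of the expansion of `O` (with `done`
set aside, directions `D` present) that have NO constant component. [cite: BalabanImbrieJaffe1988, §5.14 p.312] -/
def remv (D : List (S → ℝ)) (done : Multiset (LGrp S κ)) (O : Finset κ) : ℝ :=
  (((expand A f c legs obs M done O).filter fun t => t.consts = 0).map (tval A f c legs χ D)).sum

variable {A f c legs obs M χ}

/-- **One observable taken up, constant part**: for `C` non-empty with least observable `i`, `cst C` is the sum over
the CONSTANT outcomes `o` of the run of `i` in `C ∖ i` (nothing set aside) of `a_o · cst(o.rest)` — the component of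
`i` is one constant component, the untouched observables organise independently.
[cite: BalabanImbrieJaffe1988, §5.14 p.312] -/
theorem cst_step {C : Finset κ} (h : C.Nonempty) :
    cst A f c legs obs M C
      = (((run A f c legs obs M (pristine obs (C.min' h)) (C.erase (C.min' h)) 0).filter fun o => o.g.IsConst M).map
          fun o => o.a * cst A f c legs obs M o.rest).sum := by
  rw [cst, expand_of_nonempty A f c legs obs M h, filter_mbind, map_mbind, sum_mbind, ← sum_map_ite,
    ← Multiset.attach_map_val' (run A f c legs obs M (pristine obs (C.min' h)) (C.erase (C.min' h)) 0)]
  refine congrArg _ (Multiset.map_congr rfl fun o _ => ?_)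
  have ho := o.2
  have hd0 : o.1.done = 0 := Multiset.le_zero.1 (run_done_le _ _ _ _ ho)
  split_ifs with hg
  · -- a constant component: the blocks do not touch `groups`; coefficients scale by `a_o`
    rw [Multiset.filter_map, Multiset.map_map, cst, hd0, ← Multiset.sum_map_mul_left]
    rfl
  · -- a remainder component is set aside: every term has a set-aside component, none is all-constant
    rw [Multiset.filter_map, Multiset.filter_eq_nil.2, Multiset.map_zero, Multiset.map_zero, Multiset.sum_zero]
    intro t ht
    have hd' : ∀ h' ∈ o.1.g ::ₘ o.1.done, h'.complete M = true := fun h' hh => by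
      rcases Multiset.mem_cons.1 hh with rfl | hh
      · exact run_complete _ _ _ _ ho
      · rw [hd0] at hh; exact absurd hh (Multiset.notMem_zero _)
    exact (expand_sound _ _ _ (Nat.lt_succ_self _) hd' t ht).2.2 (Multiset.cons_ne_zero)

/-- **One observable taken up, remainder part**: for `i` below every observable of `O'`, `remv D done (insert i O')`
is the sum over the REMAINDER outcomes `o` of the run of `i` in `O'` of `a_o · remv (D ++ D_o) (o.g :: o.done) o.rest`.
[cite: BalabanImbrieJaffe1988, §5.14 p.312] -/
theorem remv_step {O' : Finset κ} {i : κ} (hi : ∀ j ∈ O', i < j) (D : List (S → ℝ)) (done : Multiset (LGrp S κ)) :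
    remv A f c legs obs M χ D done (insert i O')
      = (((run A f c legs obs M (pristine obs i) O' done).filter fun o => ¬ o.g.IsConst M).map
          fun o => o.a * remv A f c legs obs M χ (D ++ o.D) (o.g ::ₘ o.done) o.rest).sum := by
  have hne : (insert i O').Nonempty := Finset.insert_nonempty _ _
  have hiO : i ∉ O' := fun h => lt_irrefl _ (hi i h)
  have hmin : (insert i O').min' hne = i :=
    le_antisymm (Finset.min'_le _ _ (Finset.mem_insert_self _ _))
      (Finset.le_min' _ _ _ fun y hy => by
        rcases Finset.mem_insert.1 hy with rfl | hy
        · exact le_rfl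
        · exact (hi y hy).le)
  have her : (insert i O').erase ((insert i O').min' hne) = O' := by rw [hmin, Finset.erase_insert hiO]
  rw [remv, expand_of_nonempty A f c legs obs M hne, filter_mbind, map_mbind, sum_mbind, ← sum_map_ite, her, hmin,
    ← Multiset.attach_map_val' (run A f c legs obs M (pristine obs i) O' done)]
  refine congrArg _ (Multiset.map_congr rfl fun o _ => ?_)
  split_ifs with hg
  · -- a constant component is booked as a block: no term without blocks
    rw [Multiset.filter_map, Multiset.filter_eq_nil.2, Multiset.map_zero, Multiset.map_zero, Multiset.sum_zero]
    intro t _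
    simp only [Function.comp_apply, RTerm.addConst_consts]
    exact Multiset.cons_ne_zero
  · rw [Multiset.filter_map, Multiset.map_map, remv, ← Multiset.sum_map_mul_left]
    refine congrArg _ (Multiset.map_congr rfl fun t _ => ?_)
    rw [Function.comp_apply, tval_act]

/-- **The blocks and the set-aside components of a term carry all the observables** (label bookkeeping for the
reading `X_c`, `X_r` ⊆ observables): for every term of `expand done rest`, the union of the labels of its constant
components and of its set-aside components is the union of the labels of `done` and `rest`.
[cite: BalabanImbrieJaffe1988, §5.14 p.311–312] -/
theorem expand_lab : ∀ (n : ℕ) (done : Multiset (LGrp S κ)) (rest : Finset κ), rest.card < n →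
    ∀ t ∈ expand A f c legs obs M done rest,
      ((t.consts + t.groups).map LGrp.lab).sup = (done.map LGrp.lab).sup ∪ rest
  | 0, _, _, hn => fun _ _ => absurd hn (Nat.not_lt_zero _)
  | n + 1, done, rest, hn => by
    intro t ht
    by_cases h : rest.Nonempty
    · rw [expand_of_nonempty A f c legs obs M h, mem_mbind] at ht
      obtain ⟨o, ho, ht⟩ := ht
      have hcard : o.rest.card < n := lt_of_lt_of_le (lt_of_le_of_lt (Finset.card_le_card (run_rest_subset _ _ _ o ho))
        (Finset.card_erase_lt_of_mem (rest.min'_mem h))) (Nat.lt_succ_iff.1 hn)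
      have hl := run_lab _ _ _ o ho
      simp only [pristine] at hl
      have hrest : (done.map LGrp.lab).sup ∪ rest = o.g.lab ∪ (o.done.map LGrp.lab).sup ∪ o.rest := by
        rw [hl, Finset.union_comm {rest.min' h}, Finset.union_assoc, ← Finset.insert_eq,
          Finset.insert_erase (rest.min'_mem h)]
      split_ifs at ht with hg
      · rw [Multiset.mem_map] at ht
        obtain ⟨t', ht', rfl⟩ := ht
        have ih := expand_lab n o.done o.rest hcard t' ht'
        rw [hrest, RTerm.addConst_consts, oact_consts, RTerm.addConst_groups, oact_groups, Multiset.cons_add,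
          Multiset.map_cons, Multiset.sup_cons, ih, Finset.sup_eq_union, Finset.union_assoc]
      · rw [Multiset.mem_map] at ht
        obtain ⟨t', ht', rfl⟩ := ht
        have ih := expand_lab n (o.g ::ₘ o.done) o.rest hcard t' ht'
        rw [hrest, oact_consts, oact_groups, ih, Multiset.map_cons, Multiset.sup_cons, Finset.sup_eq_union,
          Finset.union_assoc]
    · rw [expand_of_not_nonempty A f c legs obs M h, Multiset.mem_singleton] at ht
      subst ht
      rw [Finset.not_nonempty_iff_eq_empty.1 h, Finset.union_empty, zero_add]

/-! ## §2  The environment lemmas in sum form -/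

/-- **A run sees only the observables it absorbs, in sums**: for `B ⊆ R`, a `φ`-stable selection `p` of outcomes and
any weight `ψ`, summing `ψ` over the selected outcomes of the run in `R` that leave `R ∖ B` untouched is summing
`ψ ∘ (rest ∪= R ∖ B)` over the selected outcomes of the run in `B`. [cite: BalabanImbrieJaffe1988, §5.14 p.312] -/
theorem sum_filter_env {g : LGrp S κ} {R B : Finset κ} (hB : B ⊆ R) (done : Multiset (LGrp S κ))
    (p : Outcome S κ → Prop) [DecidablePred p] (hp : ∀ o : Outcome S κ, p { o with rest := o.rest ∪ (R \ B) } ↔ p o)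
    (ψ : Outcome S κ → ℝ) :
    (((run A f c legs obs M g R done).filter p).map fun o => if R \ B ⊆ o.rest then ψ o else 0).sum
      = (((run A f c legs obs M g B done).filter p).map fun o => ψ { o with rest := o.rest ∪ (R \ B) }).sum := by
  rw [sum_map_ite, Multiset.filter_filter]
  have e : (run A f c legs obs M g R done).filter (fun o => R \ B ⊆ o.rest ∧ p o)
      = ((run A f c legs obs M g R done).filter fun o => R \ B ⊆ o.rest).filter p := by
    rw [Multiset.filter_filter]
    exact Multiset.filter_congr fun o _ => and_comm
  rw [e, run_filter_env _ _ _ _ (Nat.lt_succ_self _) B hB, Multiset.filter_map, Multiset.map_map]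
  refine congrArg _ (Multiset.map_congr ?_ fun o _ => rfl)
  exact Multiset.filter_congr fun o _ => hp o

/-- The constant part seen from a bigger environment: for `O ⊆ R`, the constant outcomes of the run in `R ∖ O`
weighted by `cst(o.rest)` are the constant outcomes of the run in `R` leaving `O` untouched, weighted by
`cst(o.rest ∖ O)`. [cite: BalabanImbrieJaffe1988, §5.14 p.312] -/
theorem cst_env {g : LGrp S κ} {R O : Finset κ} (hO : O ⊆ R) :
    (((run A f c legs obs M g (R \ O) 0).filter fun o => o.g.IsConst M).map
        fun o => o.a * cst A f c legs obs M o.rest).sum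
      = (((run A f c legs obs M g R 0).filter fun o => o.g.IsConst M).map
        fun o => if O ⊆ o.rest then o.a * cst A f c legs obs M (o.rest \ O) else 0).sum := by
  have hRO : R \ (R \ O) = O := Finset.sdiff_sdiff_eq_self hO
  have h := sum_filter_env (A := A) (f := f) (c := c) (legs := legs) (obs := obs) (M := M) (g := g)
    (Finset.sdiff_subset : R \ O ⊆ R) 0 (fun o => o.g.IsConst M) (fun o => Iff.rfl)
    (fun o => o.a * cst A f c legs obs M (o.rest \ O))
  rw [hRO] at h
  rw [h]
  refine congrArg _ (Multiset.map_congr rfl fun o ho => ?_)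
  have hr : o.rest ⊆ R \ O := run_rest_subset _ _ _ o (Multiset.mem_of_mem_filter ho)
  have hd : Disjoint o.rest O := Finset.disjoint_of_subset_left hr Finset.sdiff_disjoint
  simp only [Finset.union_sdiff_cancel_right hd]

/-- The remainder part seen from a bigger environment: for `O' ⊆ R`, the remainder outcomes of the run in `O'`
weighted by `remv(…, o.rest)` are the remainder outcomes of the run in `R` leaving `R ∖ O'` untouched, weighted by
`remv(…, o.rest ∖ (R ∖ O'))`. [cite: BalabanImbrieJaffe1988, §5.14 p.312] -/
theorem remv_env {g : LGrp S κ} {R O' : Finset κ} (hO' : O' ⊆ R) (D : List (S → ℝ)) (done : Multiset (LGrp S κ)) :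
    (((run A f c legs obs M g O' done).filter fun o => ¬ o.g.IsConst M).map
        fun o => o.a * remv A f c legs obs M χ (D ++ o.D) (o.g ::ₘ o.done) o.rest).sum
      = (((run A f c legs obs M g R done).filter fun o => ¬ o.g.IsConst M).map
        fun o => if R \ O' ⊆ o.rest then o.a * remv A f c legs obs M χ (D ++ o.D) (o.g ::ₘ o.done) (o.rest \ (R \ O'))
          else 0).sum := by
  have h := sum_filter_env (A := A) (f := f) (c := c) (legs := legs) (obs := obs) (M := M) (g := g) hO' done
    (fun o => ¬ o.g.IsConst M) (fun o => Iff.rfl)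
    (fun o => o.a * remv A f c legs obs M χ (D ++ o.D) (o.g ::ₘ o.done) (o.rest \ (R \ O')))
  rw [h]
  refine congrArg _ (Multiset.map_congr rfl fun o ho => ?_)
  have hr : o.rest ⊆ O' := run_rest_subset _ _ _ o (Multiset.mem_of_mem_filter ho)
  have hd : Disjoint o.rest (R \ O') := Finset.disjoint_of_subset_left hr Finset.disjoint_sdiff
  simp only [Finset.union_sdiff_cancel_right hd]

/-! ## §3  The resummation -/

omit [Fintype S] [DecidableEq S] in
/-- `rest ∖ insert i O' = (rest ∖ i) ∖ O'` (bookkeeping). [cite: BalabanImbrieJaffe1988, §5.14 p.312] -/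
theorem sdiff_insert_eq_erase_sdiff (rest O' : Finset κ) (i : κ) : rest \ insert i O' = rest.erase i \ O' := by
  ext x
  simp only [Finset.mem_sdiff, Finset.mem_insert, Finset.mem_erase, not_or]
  tauto

omit [Fintype S] [DecidableEq S] in
/-- `(rest ∖ O).erase i = (rest ∖ i) ∖ O` (bookkeeping). [cite: BalabanImbrieJaffe1988, §5.14 p.312] -/
theorem sdiff_erase_eq_erase_sdiff (rest O : Finset κ) (i : κ) : (rest \ O).erase i = rest.erase i \ O := by
  ext x
  simp only [Finset.mem_sdiff, Finset.mem_erase]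
  tauto

/-- **THE RESUMMATION OVER THE CONSTANT COMPONENTS** (p. 312, first display, second equality — derived): for complete
components `done` set aside, untouched observables `rest` and `χ′`-directions `D` already present,
`Σ_{t ∈ expand done rest} tval D t = Σ_{O ⊆ rest} cst(rest ∖ O) · remv D done O` — the observables `rest ∖ O` that
end in constant components contribute the field-independent factor `cst(rest ∖ O)` (all their constant-component
structures, each component its `F^L`), computed from `rest ∖ O` ALONE; the observables `O` that end in remainder
components contribute `remv D done O`, computed from `O` (and what was set aside) ALONE.
[cite: BalabanImbrieJaffe1988, §5.14 p.312] -/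
theorem expand_resum : ∀ (n : ℕ) (done : Multiset (LGrp S κ)) (rest : Finset κ), rest.card < n →
    (∀ h ∈ done, h.complete M = true) → ∀ D : List (S → ℝ),
      ((expand A f c legs obs M done rest).map (tval A f c legs χ D)).sum
        = ∑ O ∈ rest.powerset, cst A f c legs obs M (rest \ O) * remv A f c legs obs M χ D done O
  | 0, _, _, hn => fun _ _ => absurd hn (Nat.not_lt_zero _)
  | n + 1, done, rest, hn => by
    intro hd D
    have IH : ∀ (done' : Multiset (LGrp S κ)) (rest' : Finset κ), rest'.card < rest.card →
        (∀ h ∈ done', h.complete M = true) → ∀ D' : List (S → ℝ),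
          ((expand A f c legs obs M done' rest').map (tval A f c legs χ D')).sum
            = ∑ O ∈ rest'.powerset, cst A f c legs obs M (rest' \ O) * remv A f c legs obs M χ D' done' O :=
      fun done' rest' hlt => expand_resum n done' rest' (lt_of_lt_of_le hlt (Nat.lt_succ_iff.1 hn))
    by_cases h : rest.Nonempty
    swap
    · -- no observable: one terminal term, `O = ∅`
      rw [Finset.not_nonempty_iff_eq_empty.1 h, Finset.powerset_empty, Finset.sum_singleton, Finset.sdiff_self, cst,
        remv, expand_of_not_nonempty A f c legs obs M Finset.not_nonempty_empty,
        expand_of_not_nonempty A f c legs obs M Finset.not_nonempty_empty, Multiset.filter_singleton, if_pos rfl,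
        Multiset.filter_singleton, if_pos rfl]
      simp
    -- the least observable `i` runs in the environment `R = rest ∖ i`
    obtain ⟨i, hi⟩ : ∃ i, i = rest.min' h := ⟨_, rfl⟩
    obtain ⟨R, hR⟩ : ∃ R, R = rest.erase i := ⟨_, rfl⟩
    have hirest : i ∈ rest := hi ▸ rest.min'_mem h
    have hiR : i ∉ R := hR ▸ Finset.notMem_erase i rest
    have hrest : rest = insert i R := by rw [hR, Finset.insert_erase hirest]
    have hRsub : R ⊆ rest := hR ▸ Finset.erase_subset i rest
    have hRcard : R.card < rest.card := hR ▸ Finset.card_erase_lt_of_mem hirest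
    have hlt : ∀ j ∈ R, i < j := fun j hj => by
      rw [hR] at hj
      exact lt_of_le_of_ne (hi ▸ Finset.min'_le _ _ (Finset.mem_of_mem_erase hj)) (Finset.ne_of_mem_erase hj).symm
    -- one observable taken up, on the right-hand side: the two halves `i ∉ O` / `i ∈ O`
    have hcstO : ∀ O ∈ R.powerset, cst A f c legs obs M (rest \ O)
        = (((run A f c legs obs M (pristine obs i) (R \ O) 0).filter fun o => o.g.IsConst M).map
            fun o => o.a * cst A f c legs obs M o.rest).sum := fun O hO => by
      have hO := Finset.mem_powerset.1 hO
      have hiO : i ∈ rest \ O := Finset.mem_sdiff.2 ⟨hirest, fun h' => hiR (hO h')⟩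
      have hne : (rest \ O).Nonempty := ⟨i, hiO⟩
      have hmin : (rest \ O).min' hne = i := by rw [hi] at hiO ⊢; exact min'_eq_of_subset h Finset.sdiff_subset hiO
      rw [cst_step hne, hmin, sdiff_erase_eq_erase_sdiff, ← hR]
    have hremO : ∀ O' ∈ R.powerset, remv A f c legs obs M χ D done (insert i O')
        = (((run A f c legs obs M (pristine obs i) O' done).filter fun o => ¬ o.g.IsConst M).map
            fun o => o.a * remv A f c legs obs M χ (D ++ o.D) (o.g ::ₘ o.done) o.rest).sum := fun O' hO' =>
      remv_step (fun j hj => hlt j (Finset.mem_powerset.1 hO' hj)) D done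
    rw [hrest, Finset.sum_powerset_insert hiR, ← hrest]
    -- THE LEFT-HAND SIDE: unfold one step; the value of each outcome's continuation
    have hL : ((expand A f c legs obs M done rest).map (tval A f c legs χ D)).sum
        = ((run A f c legs obs M (pristine obs i) R done).map fun o =>
            if o.g.IsConst M then o.a * ((expand A f c legs obs M done o.rest).map (tval A f c legs χ D)).sum
            else o.a * ((expand A f c legs obs M (o.g ::ₘ o.done) o.rest).map (tval A f c legs χ (D ++ o.D))).sum).sum := by
      rw [expand_of_nonempty A f c legs obs M h, map_mbind, sum_mbind, ← hi, ← hR,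
        ← Multiset.attach_map_val' (run A f c legs obs M (pristine obs i) R done)]
      refine congrArg _ (Multiset.map_congr rfl fun o _ => ?_)
      have ho := o.2
      split_ifs with hg
      · obtain ⟨hD0, hdone⟩ := run_const _ _ _ _ ho hd hg
        rw [Multiset.map_map, ← Multiset.sum_map_mul_left]
        refine congrArg _ (Multiset.map_congr (by rw [hdone]) fun t _ => ?_)
        rw [Function.comp_apply, tval_addConst, tval_act, hD0, List.append_nil]
      · rw [Multiset.map_map, ← Multiset.sum_map_mul_left]
        refine congrArg _ (Multiset.map_congr rfl fun t _ => ?_)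
        rw [Function.comp_apply, tval_act]
    rw [hL, ← Multiset.filter_add_not (fun o => o.g.IsConst M) (run A f c legs obs M (pristine obs i) R done),
      Multiset.map_add, Multiset.sum_add]
    refine congrArg₂ (· + ·) ?_ ?_
    · -- CONSTANT outcomes: the component of `i` is a constant component; it saw neither `done` nor `O`
      have e1 : (((run A f c legs obs M (pristine obs i) R done).filter fun o => o.g.IsConst M).map fun o =>
            if o.g.IsConst M then o.a * ((expand A f c legs obs M done o.rest).map (tval A f c legs χ D)).sum
            else o.a * ((expand A f c legs obs M (o.g ::ₘ o.done) o.rest).map (tval A f c legs χ (D ++ o.D))).sum).sum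
          = (((run A f c legs obs M (pristine obs i) R 0).filter fun o => o.g.IsConst M).map fun o =>
            ∑ O ∈ R.powerset, (if O ⊆ o.rest then o.a * cst A f c legs obs M (o.rest \ O) else 0)
              * remv A f c legs obs M χ D done O).sum := by
        rw [run_filter_const _ _ _ _ (Nat.lt_succ_self _) hd, Multiset.map_map]
        refine congrArg _ (Multiset.map_congr rfl fun o ho => ?_)
        obtain ⟨ho', hg⟩ := Multiset.mem_filter.1 ho
        have hsub : o.rest ⊆ R := run_rest_subset _ _ _ o ho'
        rw [Function.comp_apply]
        simp only [if_pos hg]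
        rw [IH done o.rest (lt_of_le_of_lt (Finset.card_le_card hsub) hRcard) hd D, Finset.mul_sum,
          ← powerset_filter_subset hsub, Finset.sum_filter]
        refine Finset.sum_congr rfl fun O _ => ?_
        split_ifs <;> ring
      rw [e1, sum_map_finset_sum_comm]
      refine Finset.sum_congr rfl fun O hO => ?_
      rw [Multiset.sum_map_mul_right, hcstO O hO, cst_env (Finset.mem_powerset.1 hO)]
    · -- REMAINDER outcomes: the component of `i` is set aside; the later components see it and `done`
      have e2 : (((run A f c legs obs M (pristine obs i) R done).filter fun o => ¬ o.g.IsConst M).map fun o =>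
            if o.g.IsConst M then o.a * ((expand A f c legs obs M done o.rest).map (tval A f c legs χ D)).sum
            else o.a * ((expand A f c legs obs M (o.g ::ₘ o.done) o.rest).map (tval A f c legs χ (D ++ o.D))).sum).sum
          = (((run A f c legs obs M (pristine obs i) R done).filter fun o => ¬ o.g.IsConst M).map fun o =>
            ∑ O' ∈ R.powerset, cst A f c legs obs M (R \ O') *
              (if R \ O' ⊆ o.rest then o.a * remv A f c legs obs M χ (D ++ o.D) (o.g ::ₘ o.done) (o.rest \ (R \ O'))
               else 0)).sum := by
        refine congrArg _ (Multiset.map_congr rfl fun o ho => ?_)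
        obtain ⟨ho', hg⟩ := Multiset.mem_filter.1 ho
        have hsub : o.rest ⊆ R := run_rest_subset _ _ _ o ho'
        have hd' : ∀ h' ∈ o.g ::ₘ o.done, h'.complete M = true := fun h' hh => by
          rcases Multiset.mem_cons.1 hh with rfl | hh
          · exact run_complete _ _ _ o ho'
          · exact hd h' (Multiset.mem_of_le (run_done_le _ _ _ o ho') hh)
        simp only [if_neg hg]
        rw [IH _ o.rest (lt_of_le_of_lt (Finset.card_le_card hsub) hRcard) hd' (D ++ o.D),
          ← sum_powerset_sdiff_reindex hsub (fun X Y => cst A f c legs obs M X * remv A f c legs obs M χ (D ++ o.D) (o.g ::ₘ o.done) Y),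
          Finset.mul_sum]
        refine Finset.sum_congr rfl fun O' _ => ?_
        split_ifs <;> ring
      rw [e2, sum_map_finset_sum_comm]
      refine Finset.sum_congr rfl fun O' hO' => ?_
      rw [Multiset.sum_map_mul_left, sdiff_insert_eq_erase_sdiff, ← hR, hremO O' hO',
        remv_env (Finset.mem_powerset.1 hO') D done]

end Literature.MathematicalPhysics.QuantumFieldTheory.BalabanImbrieJaffe1984to88.BIJ88Resummation312

end
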